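import Literature.AlgebraicGeometry.Motives.AbelianVarietyWeilPairingBiprod
import HarnessLib

/-!
# The Weil pairing of an `n`-ary product polarisation: `ē_N^{Σ_c π_c^* W_c}(P, Q) = ∏_c ē_N^{W_c}(π_c P, π_c Q)`

Layer `Literature/AlgebraicGeometry/Motives`, namespace `Literature.AlgebraicGeometry.Motives.AbelianVariety`.
KERNEL ONLY: theorems; no definition, no named fact, no instance, no `sorry`.

The tree's Cartier divisors (`Motives/CartierDivisor`) are PRESENTATIONS `(U i, f i)`: they carry `+`, `n •` and `0`
(`CartierDivisor.add`, `.nsmul`, `0 = div 1`) but no `AddCommMonoid` structure (`+` is associative and commutative only up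
to `CartierDivisor.SameDivisor`), so a finite family of divisors is summed DEF-FREE as a right fold
`l.foldr (· + ·) 0` over a list.  For an abelian variety `Y` over a field `K` presented by dominant homomorphisms
`π c : Y → J c` (`c ∈ C`; e.g. the projections of a biproduct `Y ≅ ⊞_c J c`, dominant by ★
`isDominant_toSchemeHom_of_comp_eq_id (π c) (ι c) (hιπ c)`), divisors `W c` on the `J c`, and the `n`-ary PRODUCT
POLARISATION DIVISOR

  `Θ_l := (l.map fun c => (W c).pullback (π c)).foldr (· + ·) 0`   (`l` a list of indices; `l = Finset.univ.toList` for all of `C`),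

the level-`N` Weil pairing (`Motives/AbelianVarietyWeilPairingLevel`, `ē_N^Θ(P, Q) = e_N(P, φ_Θ Q)`) is the product of the
factors' pairings at the projected points:

* `weilPairingLevel_foldr_add` — `ē_N^{l.foldr (+) 0}(P, Q) = ∏_{Θ ∈ l} ē_N^Θ(P, Q)` (bilinearity in the divisor,
  ★ `weilPairingLevel_add` / `weilPairingLevel_zero`, Lang VII §2 Prop. 3);
* **`weilPairingLevel_foldr_pullback`** — `ē_N^{Θ_l}(P, Q) = ∏_{c ∈ l} ē_N^{W c}(π_c P, π_c Q)` (+ functoriality under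
  the dominant `π c`, ★ `weilPairingLevel_pullback`, Mumford §20 (3));
* **`weilPairingLevel_fan`** — for `C` finite and `l = Finset.univ.toList`:
  `ē_N^{Θ}(P, Q) = ∏_c ē_N^{W c}(π_c P, π_c Q)` (`Finset.prod_map_toList`) — token for token the `hpair` hypothesis of
  `AbelianVariety.levelAdjoint_fan_entry` (cell currency, A-p18 (g11)) and of the d6 `GSComplexModel`;
* `weilPairingLevel_eq_prod_of_sameDivisor_fan` — the same for any presentation `Θ′` with `Θ′.SameDivisor Θ`
  (★ `weilPairingLevel_congr_sameDivisor`), so a consumer may re-present the sum.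

This is Mumford, *Abelian Varieties* §20 (the Riemann form of `L₁ ⊠ ⋯ ⊠ L_n` is the orthogonal sum; property (3) of
`e_n`, p. 186) and Lang, *Abelian Varieties* VII §2 Prop. 3 (bilinearity of `e_n(a, X)` in `X`), iterated; the binary case is
★ `weilPairingLevel_biprod` (`Motives/AbelianVarietyWeilPairingBiprod`).

Use (cell `hodgecm-mathlib`, D-0151, crux HLiu418 = stmt-HodgeConjecture-24832, d6 line, `stub_RosH` glue): the complex
model `Y = ⊞_c J(E′_c)` of the Albanese of a unitary Shimura curve carries the product `Θ′ = Σ_c π_c^* W_c` of Riemann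
theta divisors of the pieces; (M) produces `Θ′` with this `hpair` field, (L) transposes matrix entries against it
(`levelAdjoint_fan_entry`).  HC_CM is proved only modulo the 7 printed citations until rung 0 closes; this file moves no
book by itself.

## References
* [MumfordAV1970] D. Mumford, *Abelian Varieties* (1970), §20 (property (3) of `e_n`, p. 186; the Riemann form of a
  product), §19.
* [Lang1983AbelianVarieties] S. Lang, *Abelian Varieties*, Ch. VII §2, Props. 2–3 (bilinearity in the divisor,
  functoriality).
* [Milne1986AbelianVarieties] J. S. Milne, *Abelian varieties*, in Cornell–Silverman (1986), §16.
-/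

universe u v

open CategoryTheory CategoryTheory.Limits AlgebraicGeometry

noncomputable section

namespace Literature.AlgebraicGeometry.Motives

namespace AbelianVariety

variable {K : Type u} [Field K]

/-! ### Sums of divisors on one abelian variety -/

section OneVariety

variable {A : AbelianVariety K} {N : ℕ} [IsDominant (Hom.toSchemeHom ((N : ℤ) • 𝟙 A))]

/-- **`ē_N^{Θ₁ + ⋯ + Θ_n}(P, Q) = ∏ᵢ ē_N^{Θᵢ}(P, Q)`** for a list of Cartier divisors summed as the right fold
`l.foldr (+) 0` (bilinearity of `e_N` in the divisor, iterated: ★ `weilPairingLevel_add`, ★ `weilPairingLevel_zero`).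
[cite: Lang1983AbelianVarieties, Ch. VII §2 Prop. 3] -/
theorem weilPairingLevel_foldr_add (l : List (CartierDivisor A.X.left)) (P Q : A.torsionPoints K N) :
    A.weilPairingLevel (l.foldr (· + ·) 0) P Q = (l.map fun Θ => A.weilPairingLevel Θ P Q).prod := by
  induction l with
  | nil => exact weilPairingLevel_zero P Q
  | cons Θ l ih => rw [List.foldr_cons, List.map_cons, List.prod_cons, weilPairingLevel_add, ih]

/-- The folded sum only matters up to `SameDivisor`: a divisor `Θ′` defining the same divisor as `l.foldr (+) 0` has the
same product pairing (★ `weilPairingLevel_congr_sameDivisor`). [cite: Lang1983AbelianVarieties, Ch. VII §2 Prop. 3] -/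
theorem weilPairingLevel_eq_prod_of_sameDivisor_foldr {Θ' : CartierDivisor A.X.left} (l : List (CartierDivisor A.X.left))
    (hΘ' : Θ'.SameDivisor (l.foldr (· + ·) 0)) (P Q : A.torsionPoints K N) :
    A.weilPairingLevel Θ' P Q = (l.map fun Θ => A.weilPairingLevel Θ P Q).prod := by
  rw [weilPairingLevel_congr_sameDivisor hΘ', weilPairingLevel_foldr_add]

end OneVariety

/-! ### The `n`-ary product polarisation of a fan `π c : Y → J c` -/

section Fan

variable {C : Type v} {Y : AbelianVariety K} {J : C → AbelianVariety K} (π : ∀ c, Y ⟶ J c)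
  [∀ c, IsDominant (Hom.toSchemeHom (π c))]
  {N : ℕ} [IsDominant (Hom.toSchemeHom ((N : ℤ) • 𝟙 Y))] [∀ c, IsDominant (Hom.toSchemeHom ((N : ℤ) • 𝟙 (J c)))]

/-- **`ē_N^{Σ_{c ∈ l} π_c^* W_c}(P, Q) = ∏_{c ∈ l} ē_N^{W_c}(π_c P, π_c Q)`**: the level Weil pairing of the product divisor
`(l.map fun c => π_c^* W_c).foldr (+) 0` of a family of dominant homomorphisms `π c : Y → J c` is the product over the list
of the factors' pairings at the projected points (★ `weilPairingLevel_add` iterated + ★ `weilPairingLevel_pullback`,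
Mumford §20 (3)). [cite: MumfordAV1970, §20 (property (3) of e_n, p. 186)] [cite: Lang1983AbelianVarieties, Ch. VII §2 Prop. 3] -/
theorem weilPairingLevel_foldr_pullback (W : ∀ c, CartierDivisor (J c).X.left) (l : List C) (P Q : Y.torsionPoints K N) :
    Y.weilPairingLevel ((l.map fun c => (W c).pullback (Hom.toSchemeHom (π c))).foldr (· + ·) 0) P Q =
      (l.map fun c => (J c).weilPairingLevel (W c)
          ⟨AlgPoints.map (π c).hom.hom.hom P.1, map_mem_torsionPoints (π c) P.2⟩
          ⟨AlgPoints.map (π c).hom.hom.hom Q.1, map_mem_torsionPoints (π c) Q.2⟩).prod := by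
  induction l with
  | nil => exact weilPairingLevel_zero P Q
  | cons c l ih =>
    rw [List.map_cons, List.foldr_cons, List.map_cons, List.prod_cons, weilPairingLevel_add, ih,
      weilPairingLevel_pullback (π c) (W c) P Q]

/-- **`ē_N^{Σ_c π_c^* W_c}(P, Q) = ∏_c ē_N^{W_c}(π_c P, π_c Q)`** over a FINITE index type, the sum presented as the right
fold over `Finset.univ.toList`: the `hpair` field of a fan / biproduct model (`AbelianVariety.levelAdjoint_fan_entry`),
token for token.  Mumford §20: the Riemann form of `L₁ ⊠ ⋯ ⊠ L_n` is the orthogonal sum of those of the `L_c`.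
[cite: MumfordAV1970, §20 (property (3) of e_n, p. 186)] [cite: Lang1983AbelianVarieties, Ch. VII §2 Prop. 3] -/
theorem weilPairingLevel_fan [Fintype C] (W : ∀ c, CartierDivisor (J c).X.left) (P Q : Y.torsionPoints K N) :
    Y.weilPairingLevel
        (((Finset.univ : Finset C).toList.map fun c => (W c).pullback (Hom.toSchemeHom (π c))).foldr (· + ·) 0) P Q =
      ∏ c, (J c).weilPairingLevel (W c)
          ⟨AlgPoints.map (π c).hom.hom.hom P.1, map_mem_torsionPoints (π c) P.2⟩
          ⟨AlgPoints.map (π c).hom.hom.hom Q.1, map_mem_torsionPoints (π c) Q.2⟩ := by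
  rw [weilPairingLevel_foldr_pullback, Finset.prod_map_toList]

/-- The `hpair` letter with the level quantified INSIDE (the shape consumed by `AbelianVariety.levelAdjoint_fan_entry` and by
the d6 complex model): for the fan divisor `Θ = Σ_c π_c^* W_c` (right fold over `Finset.univ.toList`) and every level `N`
with `[N]` dominant, `ē_N^{Θ}(P, Q) = ∏_c ē_N^{W_c}(π_c P, π_c Q)`. [cite: MumfordAV1970, §20 (property (3) of e_n, p. 186)] -/
theorem weilPairingLevel_fan_forall [Fintype C] {Y : AbelianVariety K} {J : C → AbelianVariety K} (π : ∀ c, Y ⟶ J c)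
    [∀ c, IsDominant (Hom.toSchemeHom (π c))] (W : ∀ c, CartierDivisor (J c).X.left) :
    ∀ (N : ℕ) [IsDominant (Hom.toSchemeHom ((N : ℤ) • 𝟙 Y))] [∀ c, IsDominant (Hom.toSchemeHom ((N : ℤ) • 𝟙 (J c)))]
      (P Q : Y.torsionPoints K N),
      Y.weilPairingLevel
          (((Finset.univ : Finset C).toList.map fun c => (W c).pullback (Hom.toSchemeHom (π c))).foldr (· + ·) 0) P Q =
        ∏ c, (J c).weilPairingLevel (W c)
            ⟨AlgPoints.map (π c).hom.hom.hom P.1, map_mem_torsionPoints (π c) P.2⟩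
            ⟨AlgPoints.map (π c).hom.hom.hom Q.1, map_mem_torsionPoints (π c) Q.2⟩ :=
  fun _ _ _ P Q => weilPairingLevel_fan π W P Q

/-- A divisor `Θ′` on `Y` defining the SAME DIVISOR as the folded fan sum (e.g. the sum re-presented on another covering,
or folded in another order) has the same product pairing `ē_N^{Θ′}(P, Q) = ∏_c ē_N^{W_c}(π_c P, π_c Q)`.
[cite: MumfordAV1970, §20 (property (3) of e_n, p. 186)] [cite: Lang1983AbelianVarieties, Ch. VII §2 Prop. 3] -/
theorem weilPairingLevel_eq_prod_of_sameDivisor_fan [Fintype C] (W : ∀ c, CartierDivisor (J c).X.left)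
    {Θ' : CartierDivisor Y.X.left}
    (hΘ' : Θ'.SameDivisor
      (((Finset.univ : Finset C).toList.map fun c => (W c).pullback (Hom.toSchemeHom (π c))).foldr (· + ·) 0))
    (P Q : Y.torsionPoints K N) :
    Y.weilPairingLevel Θ' P Q =
      ∏ c, (J c).weilPairingLevel (W c)
          ⟨AlgPoints.map (π c).hom.hom.hom P.1, map_mem_torsionPoints (π c) P.2⟩
          ⟨AlgPoints.map (π c).hom.hom.hom Q.1, map_mem_torsionPoints (π c) Q.2⟩ := by
  rw [weilPairingLevel_congr_sameDivisor hΘ', weilPairingLevel_fan]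

end Fan

end AbelianVariety

end Literature.AlgebraicGeometry.Motives

end
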